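import Literature.AlgebraicGeometry.VanGeemen1994.WeilTypeSurfaceNonCMSquare
import Summits.HodgeConjecture.CorCM.Assembly.NonCMEllipticCurveExists
import HarnessLib

/-!
# The vendored form of van Geemen's Theorem 6.12 (`VanGeemen1994_thm612`, `0 < n`) is false

`not_vanGeemen1994_thm612 : ¬ Literature.AlgebraicGeometry.VanGeemen1994.VanGeemen1994_thm612`, unconditionally.

The Literature theorem `VanGeemen1994.not_vanGeemen1994_thm612_of_hodgeEndTrivial` (file
`VanGeemen1994/WeilTypeSurfaceNonCMSquare`) refutes the named fact from any elliptic curve `E` without complex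
multiplication (`EllipticCurve.HodgeEndTrivial E`): the square `E × E ⊂ ℚ(i)` is an abelian surface of Weil
type with `Hod = SU_H` whose Weil plane lies in `D¹ = B¹`, against the fact's conjunct `Dⁿ ∩ W_K = 0` at
`n = 1`. Such a curve exists — `NonCMCurve.exists_ellipticCurve_hodgeEndTrivial` (this directory; Riemann's
essential-image theorem is proved Summits-side, which is the only reason this corollary lives under `Summits/`).

CONSEQUENCE for the tree: every theorem carrying a binder `(h612 : VanGeemen1994_thm612)` (Ring-2 rows of
`Summits/HodgeConjecture/HodgeConjecture/Theorems/Ring2TransportWeilTypeGeneral`, `…/Ring2HypothesesLandherrRebase`,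
`…/Ring2HypothesesCMPowerAnchors`) is vacuous; the corrected statement (`2 ≤ n`) is the Literature THEOREM
`VanGeemen1994.VanGeemen1994_thm612_corrected_holds`, already used by `…/Ring2TransportWeilTypeGeneralDischarged`.
HONEST SCOPE: a statement about one vendored hypothesis; nothing here bears on HC_CM or on the summit.

## References

* [vanGeemen1994HodgeAV] B. van Geemen, *An introduction to the Hodge conjecture for abelian varieties*,
  LNM 1594 (1994), Thm. 6.12, Thm. 4.11 ("with `n > 1`"), 5.4, 2.4.
* [MoonenZarhin1999LowDim] B. Moonen, Yu. Zarhin, *Hodge classes on abelian varieties of low dimension*,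
  Math. Ann. 315 (1999), §2 (`g = 1`, Type I(1)).
-/

namespace Summit.HodgeConjecture.CorCM.NonCMCurve

/-- **`VanGeemen1994_thm612` is false**: the named fact (van Geemen 1994 Thm. 6.12 vendored over `0 < n`)
fails at `n = 1` for the square of a non-CM elliptic curve, and a non-CM elliptic curve exists.
[cite: vanGeemen1994HodgeAV, Thm. 6.12, 5.4 and 2.4] [cite: MoonenZarhin1999LowDim, §2 (g = 1), Type I(1)] -/
theorem not_vanGeemen1994_thm612 :
    ¬ Literature.AlgebraicGeometry.VanGeemen1994.VanGeemen1994_thm612 := by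
  obtain ⟨E, hE, hT⟩ := exists_ellipticCurve_hodgeEndTrivial
  exact Literature.AlgebraicGeometry.VanGeemen1994.not_vanGeemen1994_thm612_of_hodgeEndTrivial hE hT

/-- Equivalent form: `VanGeemen1994_thm612 ↔ False`, for rewriting binders `(h612 : VanGeemen1994_thm612)`.
[cite: vanGeemen1994HodgeAV, Thm. 6.12] -/
theorem vanGeemen1994_thm612_iff_false :
    Literature.AlgebraicGeometry.VanGeemen1994.VanGeemen1994_thm612 ↔ False :=
  ⟨not_vanGeemen1994_thm612, False.elim⟩

end Summit.HodgeConjecture.CorCM.NonCMCurve
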